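import Summits.Ventures.CertifiedArithmetic.Expansions.Orient2dStageCBounds
import Mathlib.Tactic.Linarith
import Mathlib.Tactic.Positivity
import Mathlib.Tactic.Ring
import Mathlib.Tactic.NormNum

/-!
# INCIRCLE, stage C, part 1: the correction terms

Shared numerical engines serving client cells; rigour lives in the verifiers; every published number
belongs to a client cell's ledger, not to the engines group. NEW WORK in the sense of this
development: the algorithm and its constants are Shewchuk's (`predicates.c`, `incircleadapt`; the
paper, §4.4 and Table 5, states line C `(3ε + 8ε²) ⊗ |det_B| ⊕ (44ε² + 576ε³) ⊗ permanent`
without a derivation), the error analysis is ours, in the standard model `|a ∘ b − fl(a ∘ b)| ≤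
ε|a ∘ b|` over `ℚ` (no underflow, no overflow) — the INCIRCLE twin of `Orient3dStageCTerms`. We
transcribe the arithmetic of stage C as hypotheses between named rationals, one per operation; we do
not hold `predicates.c` in this tree and nothing here is a claim about the C code itself.

THE OBJECT. When stage B of `incircleadapt` falls through, the six coordinate differences `x = a_x ⊖
d_x, …` are given their roundoff tails `xt` (TWO-DIFF-TAIL: `x + xt` is the exact difference, `|xt|
≤ ε|x|`), and unless all six tails vanish stage C adds to the stage-B value `det_B` the first-order
correction, summed left to right over the three cyclic terms,
`c = ⊕_z [ L_z ⊗ (((x₁ ⊗ y₁t) ⊕ (y₁ ⊗ x₁t)) ⊖ ((x₂ ⊗ y₂t) ⊕ (y₂ ⊗ x₂t))) ⊕ (2(x ⊗ xt ⊕ y ⊗ yt))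
⊗ (P ⊖ Q) ]`, where, for the cyclic term of the point whose differences are `(x, y)`, `L = (x ⊗ x)
⊕ (y ⊗ y)` is its COMPUTED lift (the one that also enters `permanent`), `x₁y₁ − x₂y₂` is its minor
and `P = x₁ ⊗ y₁`, `Q = x₂ ⊗ y₂` are the minor's stage-A products (term `a`: `(x, y) = (x_a,
y_a)`, `(x₁, y₁, x₂, y₂) = (x_b, y_c, y_b, x_c)`; cyclically for `b`, `c`); the doubling is exact.

THE RESULTS (`0 ≤ ε`; `ℓ = x² + y²` the exact lift of the computed differences, `L ≥ 0` the
computed one, assumed to satisfy `|ℓ − L| ≤ (2ε + ε²)L` and `ℓ ≤ (1 + ε)²L` (`sumSq_sub_lift_le` of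
part 2, `sumSq_le_of_rel` of `IncircleStageBBounds`); `A = |P| + |Q|`, `S'_z = L_z·A_z`):
* `incircleCInner_sub_le` — the inner factor `d` against `C₁ = x₁y₁t + y₁x₁t − x₂y₂t − y₂x₂t`:
  `|d − C₁| ≤ (6ε² + 12ε³ + 8ε⁴ + 2ε⁵)A`, `|d| ≤ (2ε + 8ε² + 12ε³ + 8ε⁴ + 2ε⁵)A`;
* `incircleCTwist_sub_le` — `g = x ⊗ xt ⊕ y ⊗ yt` against `G = x·xt + y·yt`: `|g − G| ≤ (2ε² +
  ε³)ℓ`, `|g| ≤ (ε + 2ε² + ε³)ℓ`;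
* `incircleCTerm_sub_le` — one cyclic term `t` against its exact first-order value `L_z = ℓ·C₁ +
  2G·(x₁y₁ − x₂y₂)`: `|t − L_z| ≤ (26ε² + 88ε³ + 134ε⁴ + 116ε⁵ + 58ε⁶ + 16ε⁷ + 2ε⁸)S'_z` and
  `|t| ≤ (4ε + 26ε² + 72ε³ + 110ε⁴ + 100ε⁵ + 54ε⁶ + 16ε⁷ + 2ε⁸)S'_z`.
The coefficients are worst-case bookkeeping (every rounding charged at its largest possible
magnitude), not tight. Part 2, `IncircleStageCSum`, treats the computed lift, the two roundings of
the three-term sum and the higher-order Taylor remainder; part 3, `IncircleStageCBounds`, assembles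
everything into the soundness of the stage-C sign test for arbitrary constants under explicit
margins; part 4, `IncircleStageCMargins`, evaluates the margins.

Evidence gathered before typing (engines; not part of the verification): in the exact rational model
(round-half-even to `p` bits, `p ∈ {4, 5, 8}`, error-free TWO-PRODUCT / TWO-DIFF, 600 cocircular,
one-ulp-perturbed or random quadruples per precision, of which 347 / 381 / 192 have a nonzero tail)
each inequality held in every trial; the worst observed values were `4.2ε²·S'_z` for the term
(proved coefficient `26ε²`), `3.0ε·S'_z` for its magnitude (`4ε`), `2.0ε²·A` for the inner factor
(`6ε²`) and `0.9ε²·ℓ` for `g` (`2ε²`). References: J. R. Shewchuk, Discrete Comput. Geom. 18 (1997)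
305–363, §4.4 and Table 5; `predicates.c` (`incircleadapt`) [Shewchuk1997].
-/

namespace Summit.Ventures.CertifiedArithmetic.Expansions

/-! ## Rounding bookkeeping -/

/-- One rounding step: from the standard-model fact `|a − r| ≤ u|a|` and a magnitude bound
`|a| ≤ M`, the absolute error `uM` and the magnitude `(1 + u)M` of the rounded result. -/
private theorem rnd_step {u a r M : ℚ} (hu : 0 ≤ u) (h : |a - r| ≤ u * |a|) (hM : |a| ≤ M) :
    |a - r| ≤ u * M ∧ |r| ≤ (1 + u) * M := by
  have h1 := h.trans (mul_le_mul_of_nonneg_left hM hu)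
  have h2 : |r| - |a| ≤ |r - a| := abs_sub_abs_le_abs_sub r a
  rw [abs_sub_comm] at h2
  exact ⟨h1, by linarith⟩

/-- A product with a tail, the magnitude folded in: `|t| ≤ u|y|` and `|x·y| ≤ N` give
`|x·t| ≤ uN`. -/
private theorem tail_mul_le {u x y t N : ℚ} (hu : 0 ≤ u) (h : |t| ≤ u * |y|)
    (hN : |x * y| ≤ N) : |x * t| ≤ u * N := by
  rw [abs_mul] at hN ⊢
  calc |x| * |t| ≤ |x| * (u * |y|) := mul_le_mul_of_nonneg_left h (abs_nonneg x)
    _ = u * (|x| * |y|) := by ring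
    _ ≤ u * N := mul_le_mul_of_nonneg_left hN hu

/-! ## The inner factor and the lift-tail factor of one cyclic term -/

/-- **The inner factor.** With the minor's computed differences `x₁, y₁, x₂, y₂`, their tails
(`|x₁t| ≤ ε|x₁|`, …), the stage-A products `P = x₁ ⊗ y₁`, `Q = x₂ ⊗ y₂` (`|x₁y₁ − P| ≤ ε|P|`) and
the seven roundings of `d = ((x₁ ⊗ y₁t) ⊕ (y₁ ⊗ x₁t)) ⊖ ((x₂ ⊗ y₂t) ⊕ (y₂ ⊗ x₂t))`:
`|d − C₁| ≤ (6ε² + 12ε³ + 8ε⁴ + 2ε⁵)(|P| + |Q|)`, `|d| ≤ (2ε + 8ε² + 12ε³ + 8ε⁴ + 2ε⁵)(|P| + |Q|)`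
and `|C₁| ≤ (2ε + 2ε²)(|P| + |Q|)`, where `C₁ = x₁y₁t + y₁x₁t − x₂y₂t − y₂x₂t` is the exact inner
factor. -/
theorem incircleCInner_sub_le {u x₁ x₁t y₁ y₁t x₂ x₂t y₂ y₂t P Q p₁ p₂ p₃ p₄ s₁ s₂ d : ℚ}
    (hu : 0 ≤ u) (hx₁t : |x₁t| ≤ u * |x₁|) (hy₁t : |y₁t| ≤ u * |y₁|)
    (hx₂t : |x₂t| ≤ u * |x₂|) (hy₂t : |y₂t| ≤ u * |y₂|)
    (hP : |x₁ * y₁ - P| ≤ u * |P|) (hQ : |x₂ * y₂ - Q| ≤ u * |Q|)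
    (hp₁ : |x₁ * y₁t - p₁| ≤ u * |x₁ * y₁t|) (hp₂ : |y₁ * x₁t - p₂| ≤ u * |y₁ * x₁t|)
    (hp₃ : |x₂ * y₂t - p₃| ≤ u * |x₂ * y₂t|) (hp₄ : |y₂ * x₂t - p₄| ≤ u * |y₂ * x₂t|)
    (hs₁ : |(p₁ + p₂) - s₁| ≤ u * |p₁ + p₂|) (hs₂ : |(p₃ + p₄) - s₂| ≤ u * |p₃ + p₄|)
    (hd : |(s₁ - s₂) - d| ≤ u * |s₁ - s₂|) :
    |d - ((x₁ * y₁t + y₁ * x₁t) - (x₂ * y₂t + y₂ * x₂t))|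
        ≤ (6 * u ^ 2 + 12 * u ^ 3 + 8 * u ^ 4 + 2 * u ^ 5) * (|P| + |Q|) ∧
      |d| ≤ (2 * u + 8 * u ^ 2 + 12 * u ^ 3 + 8 * u ^ 4 + 2 * u ^ 5) * (|P| + |Q|) ∧
      |(x₁ * y₁t + y₁ * x₁t) - (x₂ * y₂t + y₂ * x₂t)| ≤ (2 * u + 2 * u ^ 2) * (|P| + |Q|) := by
  have hP0 := abs_nonneg P
  have hQ0 := abs_nonneg Q
  have hP' : |x₁ * y₁| ≤ (1 + u) * |P| := by linarith [abs_sub_abs_le_abs_sub (x₁ * y₁) P]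
  have hQ' : |x₂ * y₂| ≤ (1 + u) * |Q| := by linarith [abs_sub_abs_le_abs_sub (x₂ * y₂) Q]
  -- the four tail products
  have b₁ : |x₁ * y₁t| ≤ u * ((1 + u) * |P|) := tail_mul_le hu hy₁t hP'
  have b₂ : |y₁ * x₁t| ≤ u * ((1 + u) * |P|) := tail_mul_le hu hx₁t (by rwa [mul_comm y₁ x₁])
  have b₃ : |x₂ * y₂t| ≤ u * ((1 + u) * |Q|) := tail_mul_le hu hy₂t hQ'
  have b₄ : |y₂ * x₂t| ≤ u * ((1 + u) * |Q|) := tail_mul_le hu hx₂t (by rwa [mul_comm y₂ x₂])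
  obtain ⟨ep₁, mp₁⟩ := rnd_step hu hp₁ b₁
  obtain ⟨ep₂, mp₂⟩ := rnd_step hu hp₂ b₂
  obtain ⟨ep₃, mp₃⟩ := rnd_step hu hp₃ b₃
  obtain ⟨ep₄, mp₄⟩ := rnd_step hu hp₄ b₄
  -- the two sums and the difference
  have bs₁ : |p₁ + p₂| ≤ 2 * ((1 + u) * (u * ((1 + u) * |P|))) := by linarith [abs_add_le p₁ p₂]
  have bs₂ : |p₃ + p₄| ≤ 2 * ((1 + u) * (u * ((1 + u) * |Q|))) := by linarith [abs_add_le p₃ p₄]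
  obtain ⟨es₁, ms₁⟩ := rnd_step hu hs₁ bs₁
  obtain ⟨es₂, ms₂⟩ := rnd_step hu hs₂ bs₂
  have bd : |s₁ - s₂| ≤ (1 + u) * (2 * ((1 + u) * (u * ((1 + u) * |P|))))
      + (1 + u) * (2 * ((1 + u) * (u * ((1 + u) * |Q|)))) := by linarith [abs_sub s₁ s₂]
  obtain ⟨ed, md⟩ := rnd_step hu hd bd
  refine ⟨?_, md.trans (le_of_eq (by ring)), ?_⟩
  · have key : d - ((x₁ * y₁t + y₁ * x₁t) - (x₂ * y₂t + y₂ * x₂t))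
        = -((s₁ - s₂) - d) - (((p₁ + p₂) - s₁) - ((p₃ + p₄) - s₂))
          - ((x₁ * y₁t - p₁) + (y₁ * x₁t - p₂) - (x₂ * y₂t - p₃) - (y₂ * x₂t - p₄)) := by ring
    rw [key]
    have a1 := abs_sub (-((s₁ - s₂) - d) - (((p₁ + p₂) - s₁) - ((p₃ + p₄) - s₂)))
      ((x₁ * y₁t - p₁) + (y₁ * x₁t - p₂) - (x₂ * y₂t - p₃) - (y₂ * x₂t - p₄))
    have a2 := abs_sub (-((s₁ - s₂) - d)) (((p₁ + p₂) - s₁) - ((p₃ + p₄) - s₂))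
    rw [abs_neg] at a2
    have a3 := abs_sub ((p₁ + p₂) - s₁) ((p₃ + p₄) - s₂)
    have a4 := abs_add_le (x₁ * y₁t - p₁) (y₁ * x₁t - p₂)
    have a5 := abs_sub ((x₁ * y₁t - p₁) + (y₁ * x₁t - p₂)) (x₂ * y₂t - p₃)
    have a6 := abs_sub ((x₁ * y₁t - p₁) + (y₁ * x₁t - p₂) - (x₂ * y₂t - p₃)) (y₂ * x₂t - p₄)
    linarith
  · have a1 := abs_sub (x₁ * y₁t + y₁ * x₁t) (x₂ * y₂t + y₂ * x₂t)
    have a2 := abs_add_le (x₁ * y₁t) (y₁ * x₁t)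
    have a3 := abs_add_le (x₂ * y₂t) (y₂ * x₂t)
    linarith

/-- **The lift-tail factor** `g = x ⊗ xt ⊕ y ⊗ yt` (three roundings; the code then doubles it
exactly): with `ℓ = x² + y²` and `G = x·xt + y·yt`, `|g − G| ≤ (2ε² + ε³)ℓ`,
`|g| ≤ (ε + 2ε² + ε³)ℓ` and `|G| ≤ εℓ`. -/
theorem incircleCTwist_sub_le {u x xt y yt g₁ g₂ g : ℚ} (hu : 0 ≤ u) (hxt : |xt| ≤ u * |x|)
    (hyt : |yt| ≤ u * |y|) (hg₁ : |x * xt - g₁| ≤ u * |x * xt|)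
    (hg₂ : |y * yt - g₂| ≤ u * |y * yt|) (hg : |(g₁ + g₂) - g| ≤ u * |g₁ + g₂|) :
    |g - (x * xt + y * yt)| ≤ (2 * u ^ 2 + u ^ 3) * (x * x + y * y) ∧
      |g| ≤ (u + 2 * u ^ 2 + u ^ 3) * (x * x + y * y) ∧
      |x * xt + y * yt| ≤ u * (x * x + y * y) := by
  have bx : |x * xt| ≤ u * (x * x) := tail_mul_le hu hxt (le_of_eq (abs_mul_self x))
  have bz : |y * yt| ≤ u * (y * y) := tail_mul_le hu hyt (le_of_eq (abs_mul_self y))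
  obtain ⟨e₁, m₁⟩ := rnd_step hu hg₁ bx
  obtain ⟨e₂, m₂⟩ := rnd_step hu hg₂ bz
  have bs : |g₁ + g₂| ≤ (1 + u) * (u * (x * x)) + (1 + u) * (u * (y * y)) := by
    linarith [abs_add_le g₁ g₂]
  obtain ⟨e₃, m₃⟩ := rnd_step hu hg bs
  refine ⟨?_, m₃.trans (le_of_eq (by ring)), by linarith [abs_add_le (x * xt) (y * yt)]⟩
  have key : g - (x * xt + y * yt) = -((g₁ + g₂) - g) - ((x * xt - g₁) + (y * yt - g₂)) := by
    ring
  rw [key]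
  have a1 := abs_sub (-((g₁ + g₂) - g)) ((x * xt - g₁) + (y * yt - g₂))
  rw [abs_neg] at a1
  have a2 := abs_add_le (x * xt - g₁) (y * yt - g₂)
  linarith

/-! ## One cyclic term of the stage-C correction -/

/-- **One cyclic term of the correction.** With the term's computed differences `x, y` and their
tails, its COMPUTED lift `L` (`0 ≤ L`, `|x² + y² − L| ≤ (2ε + ε²)L`, `x² + y² ≤ (1 + ε)²L`), the
minor's data as in `incircleCInner_sub_le`, the lift-tail factor `g` as in `incircleCTwist_sub_le`,
and the four roundings `m = L ⊗ d`, `e = P ⊖ Q`, `n = (2g) ⊗ e`, `t = m ⊕ n`: the computed term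
`t` is within `(26ε² + 88ε³ + 134ε⁴ + 116ε⁵ + 58ε⁶ + 16ε⁷ + 2ε⁸)·L(|P| + |Q|)` of the exact
first-order term `L_z = (x² + y²)C₁ + 2(x·xt + y·yt)(x₁y₁ − x₂y₂)`, and `|t| ≤ (4ε + 26ε² + 72ε³
+ 110ε⁴ + 100ε⁵ + 54ε⁶ + 16ε⁷ + 2ε⁸)·L(|P| + |Q|)`. -/
theorem incircleCTerm_sub_le
    {u x xt y yt L x₁ x₁t y₁ y₁t x₂ x₂t y₂ y₂t P Q p₁ p₂ p₃ p₄ s₁ s₂ d g₁ g₂ g m e n t : ℚ}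
    (hu : 0 ≤ u) (hxt : |xt| ≤ u * |x|) (hyt : |yt| ≤ u * |y|) (hL0 : 0 ≤ L)
    (hLe : |(x * x + y * y) - L| ≤ (2 * u + u ^ 2) * L) (hLm : x * x + y * y ≤ (1 + u) ^ 2 * L)
    (hx₁t : |x₁t| ≤ u * |x₁|) (hy₁t : |y₁t| ≤ u * |y₁|)
    (hx₂t : |x₂t| ≤ u * |x₂|) (hy₂t : |y₂t| ≤ u * |y₂|)
    (hP : |x₁ * y₁ - P| ≤ u * |P|) (hQ : |x₂ * y₂ - Q| ≤ u * |Q|)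
    (hp₁ : |x₁ * y₁t - p₁| ≤ u * |x₁ * y₁t|) (hp₂ : |y₁ * x₁t - p₂| ≤ u * |y₁ * x₁t|)
    (hp₃ : |x₂ * y₂t - p₃| ≤ u * |x₂ * y₂t|) (hp₄ : |y₂ * x₂t - p₄| ≤ u * |y₂ * x₂t|)
    (hs₁ : |(p₁ + p₂) - s₁| ≤ u * |p₁ + p₂|) (hs₂ : |(p₃ + p₄) - s₂| ≤ u * |p₃ + p₄|)
    (hd : |(s₁ - s₂) - d| ≤ u * |s₁ - s₂|)
    (hg₁ : |x * xt - g₁| ≤ u * |x * xt|) (hg₂ : |y * yt - g₂| ≤ u * |y * yt|)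
    (hg : |(g₁ + g₂) - g| ≤ u * |g₁ + g₂|)
    (hm : |L * d - m| ≤ u * |L * d|) (he : |(P - Q) - e| ≤ u * |P - Q|)
    (hn : |(2 * g) * e - n| ≤ u * |(2 * g) * e|) (ht : |(m + n) - t| ≤ u * |m + n|) :
    |t - ((x * x + y * y) * ((x₁ * y₁t + y₁ * x₁t) - (x₂ * y₂t + y₂ * x₂t))
        + 2 * (x * xt + y * yt) * (x₁ * y₁ - x₂ * y₂))|
        ≤ (26 * u ^ 2 + 88 * u ^ 3 + 134 * u ^ 4 + 116 * u ^ 5 + 58 * u ^ 6 + 16 * u ^ 7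
          + 2 * u ^ 8) * (L * (|P| + |Q|)) ∧
      |t| ≤ (4 * u + 26 * u ^ 2 + 72 * u ^ 3 + 110 * u ^ 4 + 100 * u ^ 5 + 54 * u ^ 6
          + 16 * u ^ 7 + 2 * u ^ 8) * (L * (|P| + |Q|)) := by
  obtain ⟨ed, md, hC₁⟩ :=
    incircleCInner_sub_le hu hx₁t hy₁t hx₂t hy₂t hP hQ hp₁ hp₂ hp₃ hp₄ hs₁ hs₂ hd
  obtain ⟨eg, mg, -⟩ := incircleCTwist_sub_le hu hxt hyt hg₁ hg₂ hg
  have hℓ0 : 0 ≤ x * x + y * y := add_nonneg (mul_self_nonneg x) (mul_self_nonneg y)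
  set ℓ := x * x + y * y with hℓ
  set C₁ := (x₁ * y₁t + y₁ * x₁t) - (x₂ * y₂t + y₂ * x₂t) with hC₁def
  have hP0 := abs_nonneg P
  have hQ0 := abs_nonneg Q
  have hP' : |x₁ * y₁| ≤ (1 + u) * |P| := by linarith [abs_sub_abs_le_abs_sub (x₁ * y₁) P]
  have hQ' : |x₂ * y₂| ≤ (1 + u) * |Q| := by linarith [abs_sub_abs_le_abs_sub (x₂ * y₂) Q]
  -- `m = L ⊗ d`
  have bm : |L * d| ≤ L * ((2 * u + 8 * u ^ 2 + 12 * u ^ 3 + 8 * u ^ 4 + 2 * u ^ 5)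
      * (|P| + |Q|)) := by
    rw [abs_mul, abs_of_nonneg hL0]; exact mul_le_mul_of_nonneg_left md hL0
  obtain ⟨em, mm⟩ := rnd_step hu hm bm
  -- `e = P ⊖ Q`, against the exact minor `x₁y₁ − x₂y₂`
  obtain ⟨ee, me⟩ := rnd_step hu he (abs_sub P Q)
  have hC₀ : |x₁ * y₁ - x₂ * y₂| ≤ (1 + u) * |P| + (1 + u) * |Q| := by
    linarith [abs_sub (x₁ * y₁) (x₂ * y₂)]
  have eC : |e - (x₁ * y₁ - x₂ * y₂)| ≤ u * (|P| + |Q|) + (u * |P| + u * |Q|) := by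
    have k : e - (x₁ * y₁ - x₂ * y₂) = -((P - Q) - e) - ((x₁ * y₁ - P) - (x₂ * y₂ - Q)) := by
      ring
    rw [k]
    have a1 := abs_sub (-((P - Q) - e)) ((x₁ * y₁ - P) - (x₂ * y₂ - Q))
    rw [abs_neg] at a1
    linarith [abs_sub (x₁ * y₁ - P) (x₂ * y₂ - Q)]
  -- `n = (2g) ⊗ e`
  have h2g : |2 * g| ≤ 2 * ((u + 2 * u ^ 2 + u ^ 3) * ℓ) := by rw [abs_mul, abs_two]; linarith
  have c2g : 0 ≤ 2 * ((u + 2 * u ^ 2 + u ^ 3) * ℓ) := by positivity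
  have bn : |2 * g * e| ≤ (2 * ((u + 2 * u ^ 2 + u ^ 3) * ℓ)) * ((1 + u) * (|P| + |Q|)) := by
    rw [abs_mul]; exact mul_le_mul h2g me (abs_nonneg e) c2g
  obtain ⟨en, mn⟩ := rnd_step hu hn bn
  -- `t = m ⊕ n`
  have bt : |m + n| ≤ (1 + u) * (L * ((2 * u + 8 * u ^ 2 + 12 * u ^ 3 + 8 * u ^ 4 + 2 * u ^ 5)
      * (|P| + |Q|))) + (1 + u) * ((2 * ((u + 2 * u ^ 2 + u ^ 3) * ℓ)) * ((1 + u)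
      * (|P| + |Q|))) := by linarith [abs_add_le m n]
  obtain ⟨et, mt⟩ := rnd_step hu ht bt
  constructor
  · -- the error decomposition
    have key : t - (ℓ * C₁ + 2 * (x * xt + y * yt) * (x₁ * y₁ - x₂ * y₂))
        = -((m + n) - t) - (L * d - m) - (2 * g * e - n) + L * (d - C₁) - (ℓ - L) * C₁
          + 2 * g * (e - (x₁ * y₁ - x₂ * y₂))
          + 2 * (g - (x * xt + y * yt)) * (x₁ * y₁ - x₂ * y₂) := by ring
    have q₄ : |L * (d - C₁)| ≤ L * ((6 * u ^ 2 + 12 * u ^ 3 + 8 * u ^ 4 + 2 * u ^ 5)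
        * (|P| + |Q|)) := by
      rw [abs_mul, abs_of_nonneg hL0]; exact mul_le_mul_of_nonneg_left ed hL0
    have q₅ : |(ℓ - L) * C₁| ≤ ((2 * u + u ^ 2) * L) * ((2 * u + 2 * u ^ 2) * (|P| + |Q|)) := by
      rw [abs_mul]; exact mul_le_mul hLe hC₁ (abs_nonneg _) (by positivity)
    have q₆ : |2 * g * (e - (x₁ * y₁ - x₂ * y₂))|
        ≤ (2 * ((u + 2 * u ^ 2 + u ^ 3) * ℓ)) * (u * (|P| + |Q|) + (u * |P| + u * |Q|)) := by
      rw [abs_mul]; exact mul_le_mul h2g eC (abs_nonneg _) c2g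
    have q₇ : |2 * (g - (x * xt + y * yt)) * (x₁ * y₁ - x₂ * y₂)|
        ≤ (2 * ((2 * u ^ 2 + u ^ 3) * ℓ)) * ((1 + u) * |P| + (1 + u) * |Q|) := by
      rw [abs_mul, abs_mul, abs_two]
      exact mul_le_mul (by linarith) hC₀ (abs_nonneg _) (by positivity)
    obtain ⟨l₁, r₁⟩ := abs_le.mp et
    obtain ⟨l₂, r₂⟩ := abs_le.mp em
    obtain ⟨l₃, r₃⟩ := abs_le.mp en
    obtain ⟨l₄, r₄⟩ := abs_le.mp q₄
    obtain ⟨l₅, r₅⟩ := abs_le.mp q₅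
    obtain ⟨l₆, r₆⟩ := abs_le.mp q₆
    obtain ⟨l₇, r₇⟩ := abs_le.mp q₇
    -- exchanging `ℓ` for `(1 + ε)²L` in the `ℓ(|P| + |Q|)` terms
    have c₀ : 0 ≤ (12 * u ^ 2 + 28 * u ^ 3 + 24 * u ^ 4 + 10 * u ^ 5 + 2 * u ^ 6)
        * (|P| + |Q|) := by positivity
    have k := mul_le_mul_of_nonneg_left hLm c₀
    rw [key, abs_le]
    constructor
    · linarith
    · linarith
  · have c₀ : 0 ≤ (2 * u + 10 * u ^ 2 + 20 * u ^ 3 + 20 * u ^ 4 + 10 * u ^ 5 + 2 * u ^ 6)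
        * (|P| + |Q|) := by positivity
    have k := mul_le_mul_of_nonneg_left hLm c₀
    linarith

end Summit.Ventures.CertifiedArithmetic.Expansions
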